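import Literature.NumberTheory.EllipticCurves.Smith2016.CongruentNumberRedeiDeterminant
import Literature.LinearAlgebra.Matrix.AdjugateRankOne

/-!
# Smith 2016, Table 1 (Rédei), the row `d ≡ 3 (mod 4)`: `g(d) ≡` a cofactor of Monsky's `A` — PROVED

Topic `NumberTheory/EllipticCurves`, namespace `Literature.NumberTheory.EllipticCurves.Smith2016`.
A pure proof file (theorems only); no named fact, nothing asserted.  Companion of
`CongruentNumberRedeiDeterminant` (the row `d ≡ 1 (mod 4)`: `g(d) ≡ det (A with a column := z)`).

## The source

A. Smith, *The congruent numbers have positive natural density*, arXiv:1603.08479v2 (2016)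
[Smith2016CongruentDensity], §2, Table 1 ("Rédei matrices for four torsion of class groups of `ℚ√−n`
with `n > 0`"; the table is absent from the held text layer and is read from the arXiv source
`cnc.tex` l. 22–34, transcribed in the cell's `lit/SMITH2016-VERBATIM-SHEET.md` §2), row `n ≡ 3 (mod 4)`:
"`g(n) = det A[[r] − {i}, [r] − {j}]` for any `1 ≤ i, j ≤ r`", i.e. for `n = p₁⋯p_r ≡ 3 (mod 4)` the
parity of `g(n) = #2Cl(ℚ(√−n))` is ANY cofactor of Monsky's/Smith's matrix `A` (`A_ij = (p_j/p_i)₊`,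
rows summing to zero).  It is used in §2.2 (chunk p0008 L42–L50) for row 3 of Thm. 2.2: "so that the
`d` corresponding to `S` is equal to `3` mod `8`, we get that this determinant equals `g(d)` per Table 1".

## The proof (Rédei–Reichardt, a tree theorem, + linear algebra over `𝔽₂`)

For `d = p₁⋯p_k ≡ 3 (mod 4)` the discriminant of `K = ℚ(√−d)` is `−d`, its prime tuple is
`(p₁, …, p_k)` itself, and the Rédei matrix `RM(−d)` IS `Aᵀ` (`redeiMatrix_eq_transpose_legendreMatrix`:
quadratic reciprocity for the `p*`, the tree's `redeiMatrix_transpose_apply`, and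
`[((d/p_i)/p_i) = −1] = Σ_{a ≠ i} (p_a/p_i)₊ = A_ii`).  By Rédei–Reichardt
(`redeiReichardt_fourTwoCard_classGroup_holds`, Li–Ma 2008 Thm. 0.4) `#ker RM(−d) = 2 · #(Cl² ∩ Cl[2])`,
so `g(d)` is odd iff `ker Aᵀ = {0, 1}`.  Since `d ≡ 3 (mod 4)`, BOTH the rows and the columns of `A`
sum to zero (Monsky's (31): `1ᵀA = (1 + Σ u) u = 0`), and for such a matrix `ker Aᵀ = {0, 1}` iff the
diagonal cofactor `adj(A)_{cc}` (any `c`) is `1`: if `adj(A)_{cc} = det U ≠ 0` for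
`U = (A with column c := e_c)`, then `Uᵀ v = v_c e_c = Uᵀ (v_c · 1)` for `v ∈ ker Aᵀ`; if `det U = 0`,
a nonzero `v ∈ ker Uᵀ` has `v_c = 0` and lies in `ker Aᵀ ∖ {0, 1}` (`card_ker_eq_two_of_adjugate_eq_one`,
`two_lt_card_ker_of_adjugate_ne_one`).  All cofactors of `A` agree
(`Literature.LinearAlgebra.Matrix.adjugate_apply_eq_adjugate_apply`), which is Smith's "for any `i, j`".
Main statements: `odd_genusClassNumber_iff_adjugate` (any `K ≅ ℚ(√−d)`),
`odd_genusClassNumber_genusField_iff_adjugate` (the tree's `GenusField d`).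

Cell `bsd-monsky` (prover-B g19).  AI provenance: written by an AI assistant; no human has reviewed it.

## References

* [Smith2016CongruentDensity] A. Smith, arXiv:1603.08479v2 (2016), §2 Table 1 (source `cnc.tex`
  l. 22–34) and §2.2 (chunk p0008 L42–L50).
* [LiMa2008] Y. Li, L. Ma, Acta Arith. 134 (2008), Lemma 0.1, Def. 0.2, Thm. 0.4 (Rédei–Reichardt).
* [HeathBrown1994SelmerCongruentII] Appendix by P. Monsky, typescript p. 39 L38, (31): `A + Aᵀ = D₋₁ + uᵀu`.
-/

open scoped Classical

open Matrix Finset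
open Literature.NumberTheory.EllipticCurves.HeathBrown1994
open Literature.NumberTheory.EllipticCurves.HeathBrown1994.Families (legendreMatrix_apply_of_ne legendreMatrix_apply_self)
open Literature.NumberTheory.EllipticCurves.MonskySelmerParity
open Literature.NumberTheory.QuadraticFields.RedeiReichardt
open Literature.NumberTheory.EllipticCurves.Tian2014 (IsQuadraticFieldOfSqrt fourTwoCard)
open Literature.NumberTheory.EllipticCurves.TianYuanZhang2017

namespace Literature.NumberTheory.EllipticCurves.Smith2016

/-! ## §1 Linear algebra over `𝔽₂`: `ker Aᵀ = {0, 1}` versus the diagonal cofactor -/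

section Kernel

variable {k : ℕ}

/-- For `A` with zero column sums, `Uᵀ·1 = e_c` where `U = (A with column c := e_c)`.
[cite: Smith2016CongruentDensity, §2 Table 1 row n ≡ 3 (4) (cofactors of A)] -/
theorem transpose_updateCol_single_mulVec_one (A : Matrix (Fin k) (Fin k) (ZMod 2))
    (hc : (1 : Fin k → ZMod 2) ᵥ* A = 0) (c : Fin k) :
    (A.updateCol c (Pi.single c 1))ᵀ *ᵥ (1 : Fin k → ZMod 2) = Pi.single c 1 := by
  rw [mulVec_transpose, vecMul_updateCol, hc]
  ext j
  by_cases hj : j = c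
  · subst hj
    simp [Function.update_self, dotProduct]
  · rw [Function.update_of_ne hj, Pi.zero_apply, Pi.single_apply, if_neg hj]

/-- For `v ∈ ker Aᵀ`, `Uᵀ·v = v_c e_c` where `U = (A with column c := e_c)`.
[cite: Smith2016CongruentDensity, §2 Table 1 row n ≡ 3 (4) (cofactors of A)] -/
theorem transpose_updateCol_single_mulVec_of_mem_ker (A : Matrix (Fin k) (Fin k) (ZMod 2))
    (c : Fin k) {v : Fin k → ZMod 2} (hv : Aᵀ *ᵥ v = 0) :
    (A.updateCol c (Pi.single c 1))ᵀ *ᵥ v = v c • (Pi.single c 1 : Fin k → ZMod 2) := by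
  rw [mulVec_transpose, vecMul_updateCol]
  rw [mulVec_transpose] at hv
  rw [hv]
  ext j
  by_cases hj : j = c
  · subst hj
    simp [Function.update_self, dotProduct, Pi.single_apply]
  · rw [Function.update_of_ne hj, Pi.zero_apply, Pi.smul_apply, Pi.single_apply, if_neg hj, smul_zero]

/-- **`adj(A)_{cc} = 1 ⟹ ker Aᵀ = {0, 1}`** (for `A` with zero column sums): every `v ∈ ker Aᵀ` is the
constant vector `v_c · 1`. [cite: Smith2016CongruentDensity, §2 Table 1 row n ≡ 3 (4)] -/
theorem eq_smul_one_of_mem_ker_of_adjugate_eq_one (A : Matrix (Fin k) (Fin k) (ZMod 2))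
    (hc : (1 : Fin k → ZMod 2) ᵥ* A = 0) {c : Fin k} (hadj : A.adjugate c c = 1)
    {v : Fin k → ZMod 2} (hv : Aᵀ *ᵥ v = 0) : v = v c • (1 : Fin k → ZMod 2) := by
  have hdet : ((A.updateCol c (Pi.single c 1))ᵀ).det ≠ 0 := by
    rw [det_transpose, ← Literature.LinearAlgebra.Matrix.adjugate_apply_self_eq_det_updateCol, hadj]
    exact one_ne_zero
  have h0 : (A.updateCol c (Pi.single c 1))ᵀ *ᵥ (v - v c • (1 : Fin k → ZMod 2)) = 0 := by
    rw [mulVec_sub, mulVec_smul, transpose_updateCol_single_mulVec_of_mem_ker A c hv,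
      transpose_updateCol_single_mulVec_one A hc c, sub_self]
  exact sub_eq_zero.mp (eq_zero_of_mulVec_eq_zero hdet h0)

/-- **`adj(A)_{cc} = 1 ⟹ #ker Aᵀ = 2`** for `A` with zero row and column sums and `k ≥ 1`: the kernel
is `{0, 1}`.  Stated for any matrix `M` equal to `Aᵀ`. [cite: Smith2016CongruentDensity, §2 Table 1 row n ≡ 3 (4)] -/
theorem card_ker_eq_two_of_adjugate_eq_one (A M : Matrix (Fin k) (Fin k) (ZMod 2)) (hM : M = Aᵀ)
    (hc : (1 : Fin k → ZMod 2) ᵥ* A = 0) {c : Fin k}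
    (hadj : A.adjugate c c = 1) :
    Fintype.card {v : Fin k → ZMod 2 // M *ᵥ v = 0} = 2 := by
  subst hM
  have h1 : Aᵀ *ᵥ (1 : Fin k → ZMod 2) = 0 := by rw [mulVec_transpose, hc]
  let e : {v : Fin k → ZMod 2 // Aᵀ *ᵥ v = 0} ≃ ZMod 2 :=
    { toFun := fun v => v.1 c
      invFun := fun b => ⟨b • (1 : Fin k → ZMod 2), by rw [mulVec_smul, h1, smul_zero]⟩
      left_inv := fun v => Subtype.ext
        (eq_smul_one_of_mem_ker_of_adjugate_eq_one A hc hadj v.2).symm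
      right_inv := fun b => by simp }
  rw [Fintype.card_congr e, ZMod.card]

/-- **`adj(A)_{cc} = 0 ⟹ #ker Aᵀ ≥ 3`** for `A` with zero row and column sums and `k ≥ 1`: a nonzero
kernel vector of `Uᵀ` (`U = (A with column c := e_c)`, singular) has `v_c = 0` and lies in `ker Aᵀ`,
beside `0` and `1`. [cite: Smith2016CongruentDensity, §2 Table 1 row n ≡ 3 (4)] -/
theorem two_lt_card_ker_of_adjugate_ne_one (A M : Matrix (Fin k) (Fin k) (ZMod 2)) (hM : M = Aᵀ)
    (hk : 0 < k) (hr : A *ᵥ (1 : Fin k → ZMod 2) = 0) (hc : (1 : Fin k → ZMod 2) ᵥ* A = 0)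
    {c : Fin k} (hadj : A.adjugate c c ≠ 1) :
    2 < Fintype.card {v : Fin k → ZMod 2 // M *ᵥ v = 0} := by
  subst hM
  have h1 : Aᵀ *ᵥ (1 : Fin k → ZMod 2) = 0 := by rw [mulVec_transpose, hc]
  have hadj0 : A.adjugate c c = 0 := by
    rcases (by decide : ∀ x : ZMod 2, x = 0 ∨ x = 1) (A.adjugate c c) with h | h
    · exact h
    · exact absurd h hadj
  have hdet : ((A.updateCol c (Pi.single c 1))ᵀ).det = 0 := by
    rw [det_transpose, ← Literature.LinearAlgebra.Matrix.adjugate_apply_self_eq_det_updateCol, hadj0]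
  obtain ⟨v, hv0, hv⟩ := exists_mulVec_eq_zero_iff.mpr hdet
  -- `v_c = 0` and `v ∈ ker Aᵀ`
  rw [mulVec_transpose, vecMul_updateCol] at hv
  have hvc : v c = 0 := by
    have := congrFun hv c
    rw [Function.update_self, Pi.zero_apply, dotProduct] at this
    rw [Fintype.sum_eq_single c (fun b hb => by simp [hb])] at this
    simpa using this
  have hvA : Aᵀ *ᵥ v = 0 := by
    rw [mulVec_transpose]
    -- all coordinates `≠ c` of `v ᵥ* A` vanish by `hv`; the coordinates sum to zero (`A·1 = 0`)
    have hoff : ∀ j, j ≠ c → (v ᵥ* A) j = 0 := fun j hj => by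
      have := congrFun hv j
      rwa [Function.update_of_ne hj, Pi.zero_apply] at this
    have hsum : ∑ j, (v ᵥ* A) j = 0 := by
      have h := dotProduct_mulVec v A (1 : Fin k → ZMod 2)
      rw [hr, dotProduct_zero] at h
      rw [dotProduct] at h
      simpa using h.symm
    ext j
    by_cases hj : j = c
    · subst hj
      rw [← Finset.add_sum_erase _ _ (mem_univ j),
        Finset.sum_eq_zero (fun i hi => hoff i (ne_of_mem_erase hi)), add_zero] at hsum
      exact hsum
    · exact hoff j hj
  refine Fintype.two_lt_card_iff.mpr ⟨⟨0, mulVec_zero _⟩, ⟨1, h1⟩, ⟨v, hvA⟩, ?_, ?_, ?_⟩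
  · intro h
    have := congrFun (congrArg Subtype.val h) ⟨0, hk⟩
    exact zero_ne_one this
  · intro h
    exact hv0 (congrArg Subtype.val h).symm
  · intro h
    have := congrFun (congrArg Subtype.val h) c
    simp only [Pi.one_apply] at this
    rw [hvc] at this
    exact one_ne_zero this

end Kernel

/-! ## §2 The Rédei matrix of `ℚ(√−d)`, `d = p₁⋯p_k ≡ 3 (mod 4)`, IS `Aᵀ` -/

section Tuple

variable {k : ℕ} (p : Fin k → ℕ)

/-- The shape "`∏ pᵢ = if d % 4 = 1 then 2d else d`" of the Rédei–Reichardt fact for `d ≡ 3 (mod 4)`: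
the prime tuple of the discriminant `−d` is `(p₁, …, p_k)` itself. [cite: LiMa2008, Lemma 0.1 (p. 279: D = −d for d ≡ 3 (mod 4))] -/
theorem prod_eq_ite_of_three_mod_four (h4 : (∏ i, p i) % 4 = 3) :
    ∏ i, p i = if (∏ i, p i) % 4 = 1 then 2 * ∏ i, p i else ∏ i, p i := by
  rw [if_neg (by omega)]

/-- **The Rédei matrix of `ℚ(√−d)` for odd `d = p₁⋯p_k ≡ 3 (mod 4)` is the TRANSPOSE of Monsky's `A`**,
entry by entry: `RM(−d)_{j i} = [(p_j/p_i) = −1] = A_ij` (`j ≠ i`) and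
`RM(−d)_{i i} = [((d/p_i)/p_i) = −1] = Σ_{a ≠ i} (p_a/p_i)₊ = A_ii`.
[cite: LiMa2008, Def. 0.2 (p. 279)] [cite: Smith2016CongruentDensity, §2 (chunk p0005 L5–L24: the matrix A) and Table 1] -/
theorem redeiMatrix_apply_eq_legendreMatrix (hp : ∀ i, (p i).Prime) (hodd : ∀ i, Odd (p i))
    (hinj : Function.Injective p) (h4 : (∏ i, p i) % 4 = 3) (j i : Fin k) :
    redeiMatrix (∏ i, p i) p j i = legendreMatrix p i j := by
  have hp2 := ne_two_of_odd p hodd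
  rw [redeiMatrix_transpose_apply hp hinj (prod_eq_ite_of_three_mod_four p h4) (hp2 i) j]
  by_cases hji : j = i
  · subst hji
    rw [if_pos rfl, prod_div_eq_prod_erase p hp j, legendreMatrix_apply_self]
    have hf : ∀ a ∈ univ.erase j, ((p a : ℕ) : ZMod (p j)) ≠ 0 := fun a ha =>
      natCast_zmod_ne_zero_of_prime_ne (hp j) (hp a) fun h => (ne_of_mem_erase ha) (hinj h)
    obtain ⟨hval, hsum⟩ := addLegendreSym_prod_left (univ.erase j) p (hp j) hf
    rw [ite_jacobiSym_eq_addLegendreSym hval, hsum]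
    exact Finset.sum_congr rfl fun a ha => by rw [legendreMatrix_apply_of_ne p (ne_of_mem_erase ha).symm]
  · rw [if_neg hji, legendreMatrix_apply_of_ne p (Ne.symm hji)]
    refine ite_jacobiSym_eq_addLegendreSym (jacobiSym_eq_one_or_neg_one_of_prime (hp i) ?_)
    rw [Int.cast_natCast]
    exact natCast_zmod_ne_zero_of_prime_ne (hp i) (hp j) fun h => hji (hinj h)

/-- `RM(−d) = Aᵀ` as matrices, `d = p₁⋯p_k ≡ 3 (mod 4)`. [cite: LiMa2008, Def. 0.2 (p. 279)] [cite: Smith2016CongruentDensity, §2 Table 1 row n ≡ 3 (4)] -/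
theorem redeiMatrix_eq_transpose_legendreMatrix (hp : ∀ i, (p i).Prime) (hodd : ∀ i, Odd (p i))
    (hinj : Function.Injective p) (h4 : (∏ i, p i) % 4 = 3) :
    redeiMatrix (∏ i, p i) p = (legendreMatrix p)ᵀ := by
  ext j i
  rw [transpose_apply, redeiMatrix_apply_eq_legendreMatrix p hp hodd hinj h4]

/-- For `d ≡ 3 (mod 4)` the COLUMNS of Monsky's `A` sum to zero as well: `1ᵀ A = (1 + Σ uᵢ) u = 0`
(Monsky's (31) with `Σ uᵢ = 1`). [cite: HeathBrown1994SelmerCongruentII, Appendix (Monsky), typescript p. 39 L34–L38, (31)] -/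
theorem one_vecMul_legendreMatrix_of_three_mod_four (hp : ∀ i, (p i).Prime) (hodd : ∀ i, Odd (p i))
    (hinj : Function.Injective p) (h4 : (∏ i, p i) % 4 = 3) :
    (1 : Fin k → ZMod 2) ᵥ* legendreMatrix p = 0 := by
  have hp2 := ne_two_of_odd p hodd
  rw [one_vecMul_legendreMatrix p hp hp2 hinj, sum_addLegendreSym_neg_one_eq p hp hp2, if_neg (by omega)]
  have : (1 : ZMod 2) + 1 = 0 := by decide
  rw [this, zero_smul]

end Tuple

/-! ## §3 Smith's Table 1, row `d ≡ 3 (mod 4)`: `g(d)` odd `⟺ adj(A)_{cc} = 1` -/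

section Genus

variable {k : ℕ} (p : Fin k → ℕ)

/-- **`g(d) ≡ adj(A)_{cc} (mod 2)`** (Smith's Table 1 via Rédei–Reichardt, a tree theorem): for
`d = p₁⋯p_k ≡ 3 (mod 4)` a product of distinct odd primes, any `K` with `[K : ℚ] = 2`, `−d ∈ K²`, and any
index `c`, the genus class number `#2Cl(K)` is odd iff the diagonal cofactor `adj(A)_{cc}` of Monsky's
matrix `A` of `d` is `1` over `𝔽₂` (all cofactors of `A` agree, the rows and columns summing to zero).
[cite: Smith2016CongruentDensity, §2 Table 1 row n ≡ 3 (4) ("g(n) = det A[[r] − {i}, [r] − {j}] for any i, j")]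
[cite: LiMa2008, Thm. 0.4 (Rédei–Reichardt)] -/
theorem odd_genusClassNumber_iff_adjugate (hp : ∀ i, (p i).Prime) (hodd : ∀ i, Odd (p i))
    (hinj : Function.Injective p) (h4 : (∏ i, p i) % 4 = 3) (c : Fin k)
    (K : Type) [Field K] [NumberField K] (hK : IsQuadraticFieldOfSqrt K (-((∏ i, p i : ℕ) : ℤ))) :
    Odd (genusClassNumber K) ↔ (legendreMatrix p).adjugate c c = 1 := by
  have hprod := prod_eq_ite_of_three_mod_four p h4
  have hk : 0 < k := pos_of_prod_eq hprod
  have hRM := redeiMatrix_eq_transpose_legendreMatrix p hp hodd hinj h4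
  have hr : legendreMatrix p *ᵥ (1 : Fin k → ZMod 2) = 0 := legendreMatrix_mulVec_one p
  have hc : (1 : Fin k → ZMod 2) ᵥ* legendreMatrix p = 0 :=
    one_vecMul_legendreMatrix_of_three_mod_four p hp hodd hinj h4
  have hcard := card_ker_redeiMatrix_eq_two_mul_fourTwoCard redeiReichardt_fourTwoCard_classGroup_holds
    hp hinj hprod K hK
  rw [odd_genusClassNumber_iff K]
  constructor
  · intro hftc
    rw [hftc, mul_one] at hcard
    by_contra hadj
    have hlt := two_lt_card_ker_of_adjugate_ne_one (legendreMatrix p) _ hRM hk hr hc hadj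
    omega
  · intro hadj
    have h2 := card_ker_eq_two_of_adjugate_eq_one (legendreMatrix p) _ hRM hc hadj
    omega

/-- **Smith's Table 1, row `d ≡ 3 (mod 4)`, on the tree's genus fields**: for `d = p₁⋯p_k ≡ 3 (mod 4)`,
`g(d) = #2Cl(ℚ(√−d))` (`genusClassNumber (GenusField d)`) is odd iff `adj(A)_{cc} = 1`.
[cite: Smith2016CongruentDensity, §2 Table 1 row n ≡ 3 (4)] [cite: LiMa2008, Thm. 0.4 (Rédei–Reichardt)] -/
theorem odd_genusClassNumber_genusField_iff_adjugate (hp : ∀ i, (p i).Prime)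
    (hodd : ∀ i, Odd (p i)) (hinj : Function.Injective p) (h4 : (∏ i, p i) % 4 = 3) (c : Fin k) :
    Odd (genusClassNumber (GenusField (∏ i, p i))) ↔ (legendreMatrix p).adjugate c c = 1 :=
  odd_genusClassNumber_iff_adjugate p hp hodd hinj h4 c (GenusField (∏ i, p i))
    (isQuadraticFieldOfSqrt_genusField (Nat.pos_of_ne_zero
      (Squarefree.ne_zero (squarefree_prod_of_injective p hp hinj))))

/-- **All cofactors of `A` agree for `d ≡ 3 (mod 4)`** (rows and columns sum to zero), so the row of
Table 1 holds with ANY cofactor `adj(A)_{ij}`: Smith's "for any `1 ≤ i, j ≤ r`".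
[cite: Smith2016CongruentDensity, §2 Table 1 row n ≡ 3 (4)] -/
theorem adjugate_legendreMatrix_apply_eq (hp : ∀ i, (p i).Prime) (hodd : ∀ i, Odd (p i))
    (hinj : Function.Injective p) (h4 : (∏ i, p i) % 4 = 3) (hk : 0 < k) (i j i' j' : Fin k) :
    (legendreMatrix p).adjugate i j = (legendreMatrix p).adjugate i' j' := by
  haveI : Nonempty (Fin k) := ⟨⟨0, hk⟩⟩
  exact Literature.LinearAlgebra.Matrix.adjugate_apply_eq_adjugate_apply (legendreMatrix p)
    (legendreMatrix_mulVec_one p) (one_vecMul_legendreMatrix_of_three_mod_four p hp hodd hinj h4) i j i' j'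

end Genus

end Literature.NumberTheory.EllipticCurves.Smith2016
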